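import Literature.AlgebraicGeometry.Motives.ProjectiveSpaceFieldPointsBijective
import Mathlib.AlgebraicGeometry.ProjectiveSpectrum.Functor
import HarnessLib

/-!
# Linear changes of coordinates of projective space and their action on points

For a field `k` and linear forms `τ₀, …, τₙ ∈ k[x₀, …, xₙ]` the substitution `xⱼ ↦ τⱼ` is a graded
`k`-algebra endomorphism `σ_τ` of `k[x₀, …, xₙ]` (`ProjectiveSpace.substGraded`, Mathlib
`GradedRingHom` / `IsHomogeneous.aeval`). When the substitution is invertible (we ask for a
substitution `τ'` with `σ_τ ∘ σ_{τ'} = id`) the irrelevant ideal is generated by its image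
(`irrelevant_le_map_substGraded`), so Mathlib's functoriality of `Proj`
(`AlgebraicGeometry.Proj.map`, `Mathlib/AlgebraicGeometry/ProjectiveSpectrum/Functor.lean`) gives
the **projective linear transformation** `ProjectiveSpace.substMap τ : ℙⁿ_k → ℙⁿ_k` over `k`
(`substMapHom_comp_projToSpec`: it commutes with the structure morphisms, checked on the cover
by the `D₊(σ_τ s)` — chart-level form `awayι_comp_substMapHom_comp_projToSpec`, Mathlib
`Proj.awayι_comp_map`), and on field-valued points it is
**`[z₀ : … : zₙ] ↦ [τ₀(z) : … : τₙ(z)]`** (`pointOfVec_comp_substMap`, via the dictionary of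
`Motives/ProjectiveSpaceFieldPoints`: through the chart `D₊(σ_τ xᵢ) → D₊(xᵢ)` the comorphism is
`Away.map σ_τ xᵢ`, and `evaluation at z ∘ Away.map σ_τ xᵢ = evaluation at τ(z)`).
Hartshorne II Ex. 2.14(b)/(c) and II.7.1.1 (automorphisms of `ℙⁿ` from linear changes of variables);
used for the negation `[X : Y : Z] ↦ [X : −Y − a₁X − a₃Z : Z]` of a Weierstrass cubic
(Silverman, *AEC* III.2.3). The `n = 1` variable swap of `Motives/ProjectiveLineInvolution`
(`ProjLine.σ`, also `Proj.map` with the same proof skeleton) is the special case this file generalises.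

## References

* R. Hartshorne, *Algebraic Geometry*, GTM 52 (1977): II Ex. 2.14, II Example 7.1.1. [Hartshorne1977]
* J. H. Silverman, *The Arithmetic of Elliptic Curves*, 2nd ed. (2009): III.2.3. [SilvermanAEC2009]
-/

noncomputable section

open CategoryTheory AlgebraicGeometry HomogeneousLocalization MvPolynomial

universe u

namespace Literature.AlgebraicGeometry.Motives

namespace ProjectiveSpace

variable {k : Type u} [Field k] {n : ℕ}

attribute [local instance] MvPolynomial.gradedAlgebra ProjBaseChange.algebraBase

local notation "𝒜" => MvPolynomial.homogeneousSubmodule (Fin (n + 1)) k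

/-! ### Substitutions by linear forms as graded ring homomorphisms -/

section Subst

variable (τ : Fin (n + 1) → MvPolynomial (Fin (n + 1)) k) (hτ : ∀ j, (τ j).IsHomogeneous 1)

/-- **The substitution `xⱼ ↦ τⱼ` by linear forms as a graded ring endomorphism of `k[x₀, …, xₙ]`**
(Mathlib `MvPolynomial.aeval`; it preserves degrees by `IsHomogeneous.aeval`).
[cite: Hartshorne1977, II Ex. 2.14] -/
def substGraded : 𝒜 →+*ᵍ 𝒜 where
  __ := (aeval τ : MvPolynomial (Fin (n + 1)) k →ₐ[k] MvPolynomial (Fin (n + 1)) k).toRingHom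
  map_mem {i x} hx := by
    have h := ((mem_homogeneousSubmodule i x).mp hx).aeval τ hτ
    rw [one_mul] at h
    exact (mem_homogeneousSubmodule i _).mpr h

/-- `substGraded τ` is `aeval τ` on elements (`rfl`). [folklore] -/
@[simp]
theorem substGraded_apply (p : MvPolynomial (Fin (n + 1)) k) : substGraded τ hτ p = aeval τ p := rfl

/-- `substGraded τ` fixes the constants. [folklore] -/
theorem substGraded_C (c : k) : substGraded τ hτ (C c) = C c := by
  rw [substGraded_apply, aeval_C, MvPolynomial.algebraMap_eq]

/-- Evaluating `σ_τ g` at `z` is evaluating `g` at `τ(z) = (τⱼ(z))ⱼ` (Mathlib `comp_aeval`). [folklore] -/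
theorem aeval_substGraded {S : Type*} [CommRing S] [Algebra k S] (z : Fin (n + 1) → S)
    (g : MvPolynomial (Fin (n + 1)) k) :
    aeval z (substGraded τ hτ g) = aeval (fun j ↦ aeval z (τ j)) g := by
  rw [substGraded_apply, ← AlgHom.comp_apply, MvPolynomial.comp_aeval]

variable (τ' : Fin (n + 1) → MvPolynomial (Fin (n + 1)) k) (hτ' : ∀ j, (τ' j).IsHomogeneous 1)
  (hinv : ∀ p, aeval τ (aeval τ' p) = p)

include hτ' hinv in
open HomogeneousIdeal in
/-- **An invertible linear substitution generates the irrelevant ideal**: if `σ_τ ∘ σ_{τ'} = id`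
then `k[x]₊ ≤ σ_τ(k[x]₊)·k[x]` (the hypothesis of Mathlib's `Proj.map`; each homogeneous `x` of
positive degree is `σ_τ (σ_{τ'} x)` with `σ_{τ'} x` again of positive degree). [folklore] -/
theorem irrelevant_le_map_substGraded : 𝒜₊ ≤ (𝒜₊).map (substGraded τ hτ) := by
  rw [← toIdeal_le_toIdeal_iff, irrelevant_eq_span, Ideal.span_le, toIdeal_map]
  intro x hx
  simp only [Set.mem_iUnion, SetLike.mem_coe, exists_prop] at hx
  obtain ⟨i, hi, hx⟩ := hx
  rw [SetLike.mem_coe, show x = substGraded τ hτ (substGraded τ' hτ' x) from (hinv x).symm]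
  exact Ideal.mem_map_of_mem _ (mem_irrelevant_of_mem _ hi ((substGraded τ' hτ').map_mem hx))

/-- **The projective linear transformation `ℙⁿ_k → ℙⁿ_k` of an invertible linear substitution**, as a
morphism of schemes (Mathlib `Proj.map` of `substGraded τ`). [cite: Hartshorne1977, II Example 7.1.1] -/
def substMapHom : Proj 𝒜 ⟶ Proj 𝒜 :=
  Proj.map (substGraded τ hτ) (irrelevant_le_map_substGraded τ hτ τ' hτ' hinv)

/-- `substMapHom` is Mathlib's `Proj.map` (`rfl`). [folklore] -/
theorem substMapHom_eq :
    substMapHom τ hτ τ' hτ' hinv = Proj.map (substGraded τ hτ) (irrelevant_le_map_substGraded τ hτ τ' hτ' hinv) :=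
  rfl

/-- On `k[x]_{(s)} → k[x]_{(σ s)}` the map of homogeneous localizations induced by `σ_τ`
(Mathlib `Away.map`) is compatible with the `k`-algebra structures. [folklore] -/
theorem awayMap_substGraded_algebraMap (s : MvPolynomial (Fin (n + 1)) k) (c : k) :
    Away.map (substGraded τ hτ) s (algebraMap k (Away 𝒜 s) c) =
      algebraMap k (Away 𝒜 (substGraded τ hτ s)) c := by
  apply HomogeneousLocalization.val_injective
  rw [ProjBaseChange.val_algebraMap, ProjBaseChange.algebraMap_eq', Away.map,
    HomogeneousLocalization.map_mk, HomogeneousLocalization.val_mk]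
  change Localization.mk (substGraded τ hτ ↑(algebraMap k (𝒜 0) c)) ⟨substGraded τ hτ 1, _⟩ = _
  simp only [SetLike.GradeZero.coe_algebraMap, MvPolynomial.algebraMap_eq, substGraded_C, map_one]
  rw [← MvPolynomial.algebraMap_eq]
  change Localization.mk (algebraMap k (MvPolynomial (Fin (n + 1)) k) c) 1 =
    algebraMap k (Localization.Away (substGraded τ hτ s)) c
  rw [Localization.mk_algebraMap]

/-- On the chart `D₊(σ_τ s) → D₊(s)` the transformation is `Spec (Away.map σ_τ s)`, a morphism over
`Spec k` (Mathlib `Proj.awayι_comp_map`). [folklore] -/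
theorem awayι_comp_substMapHom_comp_projToSpec {i : ℕ} (hi : 0 < i) (s : MvPolynomial (Fin (n + 1)) k)
    (hs : s ∈ 𝒜 i) :
    Proj.awayι 𝒜 (substGraded τ hτ s) ((substGraded τ hτ).map_mem hs) hi ≫ substMapHom τ hτ τ' hτ' hinv ≫
        ProjBaseChangeRing.projToSpec (Fin (n + 1)) k =
      Proj.awayι 𝒜 (substGraded τ hτ s) ((substGraded τ hτ).map_mem hs) hi ≫
        ProjBaseChangeRing.projToSpec (Fin (n + 1)) k := by
  rw [substMapHom_eq, Proj.awayι_comp_map_assoc _ _ hi s hs, ProjBaseChangeRing.awayι_projToSpec,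
    ProjBaseChangeRing.awayι_projToSpec, ← Spec.map_comp, ← CommRingCat.ofHom_comp]
  congr 2
  exact RingHom.ext fun c ↦ awayMap_substGraded_algebraMap τ hτ s c

/-- **`substMapHom` is a morphism over `Spec k`** (checked on the open cover of the source by the
`D₊(σ_τ s)`, Mathlib `Proj.mapAffineOpenCover`). [folklore] -/
theorem substMapHom_comp_projToSpec :
    substMapHom τ hτ τ' hτ' hinv ≫ ProjBaseChangeRing.projToSpec (Fin (n + 1)) k =
      ProjBaseChangeRing.projToSpec (Fin (n + 1)) k := by
  refine (Proj.mapAffineOpenCover (substGraded τ hτ)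
    (irrelevant_le_map_substGraded τ hτ τ' hτ' hinv)).openCover.hom_ext _ _ fun s ↦ ?_
  rw [Scheme.AffineOpenCover.openCover_f, Proj.mapAffineOpenCover_f]
  exact awayι_comp_substMapHom_comp_projToSpec τ hτ τ' hτ' hinv s.1.2 s.2 s.2.2

/-- **The projective linear transformation of `ℙⁿ_k` over `k`** attached to an invertible linear
substitution `xⱼ ↦ τⱼ`. [cite: Hartshorne1977, II Example 7.1.1] -/
def substMap : projectiveSpace n k ⟶ projectiveSpace n k :=
  Over.homMk (substMapHom τ hτ τ' hτ' hinv) (substMapHom_comp_projToSpec τ hτ τ' hτ' hinv)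

/-- The underlying morphism of `substMap` is `Proj.map σ_τ`. [folklore] -/
@[simp]
theorem substMap_left : (substMap τ hτ τ' hτ' hinv).left = substMapHom τ hτ τ' hτ' hinv := rfl

/-- `substMap` pulls the basic open `D₊(s)` back to `D₊(σ_τ s)` (Mathlib `Proj.map_preimage_basicOpen`).
[folklore] -/
theorem substMap_preimage_basicOpen (s : MvPolynomial (Fin (n + 1)) k) :
    (substMap τ hτ τ' hτ' hinv).left ⁻¹ᵁ Proj.basicOpen 𝒜 s = Proj.basicOpen 𝒜 (substGraded τ hτ s) :=
  rfl

end Subst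

/-! ### The action on field-valued points -/

section Points

variable {L : Type u} [Field L] [Algebra k L]
variable (τ : Fin (n + 1) → MvPolynomial (Fin (n + 1)) k) (hτ : ∀ j, (τ j).IsHomogeneous 1)
  (τ' : Fin (n + 1) → MvPolynomial (Fin (n + 1)) k)

/-- The value `τ(z) = (τ₀(z), …, τₙ(z))` of the substitution at a vector `z`. [folklore] -/
def substVec (z : Fin (n + 1) → L) : Fin (n + 1) → L := fun j ↦ aeval z (τ j)

/-- `substVec τ z j = τⱼ(z)` (`rfl`). [folklore] -/
@[simp]
theorem substVec_apply (z : Fin (n + 1) → L) (j : Fin (n + 1)) : substVec τ z j = aeval z (τ j) := rfl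

/-- `(σ_τ g)(z) = g(τ(z))`. [folklore] -/
theorem aeval_substGraded_eq (z : Fin (n + 1) → L) (g : MvPolynomial (Fin (n + 1)) k) :
    aeval z (substGraded τ hτ g) = aeval (substVec τ z) g :=
  aeval_substGraded τ hτ z g

/-- **Evaluation at `z` after `Away.map σ_τ xᵢ` is evaluation at `τ(z)`**: the comorphism of the
projective linear transformation on the charts `D₊(σ_τ xᵢ) → D₊(xᵢ)`, composed with an `L`-point.
[folklore] -/
theorem awayEval_comp_awayMap_substGraded (z : Fin (n + 1) → L) (i : Fin (n + 1))
    (hz : aeval z (substGraded τ hτ (X i)) ≠ 0) (hz' : aeval (substVec τ z) (X i : MvPolynomial _ k) ≠ 0) :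
    (awayEval z hz).toRingHom.comp (Away.map (substGraded τ hτ) (X i)) = (awayEval (substVec τ z) hz').toRingHom := by
  ext q
  obtain ⟨m, g, hg, rfl⟩ := q.mk_surjective _ (X_mem i)
  rw [RingHom.comp_apply, Away.map_mk]
  change awayEval z hz _ = awayEval (substVec τ z) hz' _
  rw [awayEval_mk, awayEval_mk, aeval_substGraded_eq, aeval_substGraded_eq]

/-- **The projective linear transformation on points: `[z] ↦ [τ(z)]`.** For an `L`-point with
homogeneous coordinates `z` (and `τ(z) ≠ 0`, automatic for an invertible substitution,
`substVec_ne_zero`), `[z] ≫ substMap τ = [τ(z)]` (Hartshorne II Ex. 2.14(b)). [cite: Hartshorne1977, II Ex. 2.14] -/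
theorem pointOfVec_comp_substMap (hτ' : ∀ j, (τ' j).IsHomogeneous 1) (hinv : ∀ p, aeval τ (aeval τ' p) = p)
    (z : Fin (n + 1) → L) (hz : z ≠ 0) (hτz : substVec τ z ≠ 0) :
    pointOfVec k z hz ≫ substMap τ hτ τ' hτ' hinv = pointOfVec k (substVec τ z) hτz := by
  obtain ⟨i, hi⟩ := Function.ne_iff.mp hτz
  have hi' : aeval (substVec τ z) (X i : MvPolynomial _ k) ≠ 0 := aeval_X_ne_zero hi
  have hzi : aeval z (substGraded τ hτ (X i)) ≠ 0 := by rwa [aeval_substGraded_eq]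
  rw [pointOfVec_eq_chartPoint z hz ((substGraded τ hτ).map_mem (X_mem i)) one_pos hzi,
    pointOfVec_eq_chartPoint _ hτz (X_mem i) one_pos hi']
  ext : 1
  rw [Over.comp_left, chartPoint_left, chartPoint_left, substMap_left, substMapHom_eq]
  change (Spec.map (CommRingCat.ofHom (awayEval z hzi).toRingHom) ≫
      Proj.awayι 𝒜 (substGraded τ hτ (X i)) ((substGraded τ hτ).map_mem (X_mem i)) one_pos) ≫
        Proj.map (substGraded τ hτ) (irrelevant_le_map_substGraded τ hτ τ' hτ' hinv) =
    Spec.map (CommRingCat.ofHom (awayEval (substVec τ z) hi').toRingHom) ≫ Proj.awayι 𝒜 (X i) (X_mem i) one_pos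
  rw [Category.assoc, Proj.awayι_comp_map _ _ one_pos (X i) (X_mem i), ← Category.assoc, ← Spec.map_comp,
    ← CommRingCat.ofHom_comp, awayEval_comp_awayMap_substGraded τ hτ z i hzi hi']

/-- For `σ_τ ∘ σ_{τ'} = id` the substitutions on vectors satisfy `τ'(τ(z)) = z`. [folklore] -/
theorem substVec_substVec (hinv : ∀ p, aeval τ (aeval τ' p) = p) (z : Fin (n + 1) → L) :
    substVec τ' (substVec τ z) = z := by
  funext j
  have h := hinv (X j)
  rw [aeval_X] at h
  change aeval (substVec τ z) (τ' j) = z j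
  rw [show aeval (substVec τ z) (τ' j) = aeval z (aeval τ (τ' j)) by
    rw [← AlgHom.comp_apply, MvPolynomial.comp_aeval]; rfl, h, aeval_X]

/-- A linear form vanishes at the zero vector. [folklore] -/
theorem aeval_zero_of_isHomogeneous_one {t : MvPolynomial (Fin (n + 1)) k} (ht : t.IsHomogeneous 1) :
    aeval (0 : Fin (n + 1) → L) t = 0 := by
  rw [aeval_zero]
  have h0 : constantCoeff t = 0 := by
    rw [constantCoeff_eq]
    exact ht.coeff_eq_zero (by simp)
  rw [h0, map_zero]

/-- For an invertible substitution, `z ≠ 0 → τ(z) ≠ 0`. [folklore] -/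
theorem substVec_ne_zero (hτ' : ∀ j, (τ' j).IsHomogeneous 1) (hinv : ∀ p, aeval τ (aeval τ' p) = p)
    {z : Fin (n + 1) → L} (hz : z ≠ 0) : substVec τ z ≠ 0 := by
  intro h0
  apply hz
  rw [← substVec_substVec τ τ' hinv z, h0]
  funext j
  rw [substVec_apply, Pi.zero_apply]
  exact aeval_zero_of_isHomogeneous_one (hτ' j)

end Points

end ProjectiveSpace

end Literature.AlgebraicGeometry.Motives
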